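import Summits.CriticalPhenomena.SAWScalingLimit.Theses.SAWBrickWallHomotopy
import Summits.CriticalPhenomena.SAWScalingLimit.Theorems.SAWBrickWallHomotopyModulusUniversalityAffineTransport
import Summits.CriticalPhenomena.SAWScalingLimit.Theorems.SAWBrickWallHomotopyModulusUniversalityOfEventualTight
import Summits.CriticalPhenomena.SAWScalingLimit.Theorems.SAWMassiveIsingTiltLatticeUniversalityConvergentUpgrade
import Literature.Probability.RandomPlanarGeometry.LatticeSimilarityCovariance
import Literature.Probability.RandomPlanarGeometry.ConformalRestrictionProofs
import Literature.Probability.RandomPlanarGeometry.LocalMartingaleProofs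
import HarnessLib

/-!
# `ModulusUniversality`, line `birth` (reshape 7): stub W1 — Lipschitz merging with the jittered law gives (R)

Helper file (`--supports stmt-CriticalPhenomena-5790`) of the line `birth` / `registered` for the crux
`SAWBrickWallHomotopy.ModulusUniversality` (skeleton
`Summits/CriticalPhenomena/SAWScalingLimit/Cruxes/ModulusUniversality/Lines/birth.lean`, reshape 7).

After reshape 7 the crux is composed from (A) `BrickWallComparison`, (H) `HexConjecture` and (R) `stub_bwRobust`:
GIVEN `HexConjecture`, for the affinity `B = diag(2, 2/√3)` the straight critical brick-wall law of a Dobrushin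
domain `E` (`SAW.brickWallLaw E.carrier δ 0`, `ℤ²` conventions), straightened by `B⁻¹`, converges in law to chordal
SLE₈⸝₃ in `B⁻¹E`.  This file proves the registered PROVABLE glue stub W1,

* `stub_bwRobust_of_jitteredLipMerging` — **(L) ⇒ (R)**: bounded-Lipschitz merging of the straight brick-wall law
  with the jittered law `SAW.embLaw hexGraph (B ∘ hexCenter) E.carrier δ x_c` for SOME jittered endpoint
  approximation (the former leaf L, literal `JitteredLipMerging`), together with `HexConjecture`, implies (R).

Proof.  The jittered curve integrals ARE hexagonal curve integrals composed with `CurveClass.map B`, exactly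
(`stub_affineTransport`, landed), and the transported endpoint approximation is a hexagonal endpoint approximation
of `B⁻¹E`; `HexConjecture` there gives an SLE₈⸝₃ random curve `Γ` of `B⁻¹E` with the hexagonal curves `→ Γ` in
law, hence `CurveClass.map B ∘ curve → CurveClass.map B ∘ Γ` in law.  So the straight brick-wall curve laws
merge on bounded Lipschitz functions with a CONVERGENT family, hence converge weakly to the same limit (the
tree's convergent upgrade `LatticeUniversality.Birth.tendsto_integral_sub_of_tendstoLaw`: bounded-Lipschitz
portmanteau, no tightness) — `tendsto_integral_brickWall_of_lipMerging`; testing on `f ∘ CurveClass.map B⁻¹`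
(`curveClass_map_symm_map`) gives `TendstoLaw` of the straightened curves to the SAME `Γ`.  All bookkeeping
tagged [folklore].
-/

noncomputable section

open MeasureTheory Filter Topology
open scoped NNReal ENNReal
open Literature.Probability.LatticeModels
open Literature.Probability.RandomPlanarGeometry

namespace Summit.CriticalPhenomena.SAWScalingLimit.Cruxes.ModulusUniversality.Birth

/-- **Straight brick-wall curve laws tested against the `B`-image of the hexagonal limit.**  Fix the affinity
`B`, a Dobrushin `E` with a `ℤ²` endpoint approximation `(a, b)` along which the straight brick-wall law is
eventually a probability measure, hexagonal endpoints `(a', b')`, and an a.e.-measurable random curve class `Γ`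
with the hexagonal curves of `(B⁻¹E, a', b')` converging in law to `Γ`.  IF the jittered curve integrals equal
the hexagonal ones composed with `CurveClass.map B` (exact affine transport) and the straight and jittered laws
merge on bounded Lipschitz test functions, THEN `∫ f(curve) dP^{BW}_{E,δ}(a,b) → E[f(CurveClass.map B (Γ))]`
for every bounded continuous `f`.  Proof: the hexagonal curves pushed by `CurveClass.map B` converge in law to
`CurveClass.map B ∘ Γ` (test on `f ∘ CurveClass.map B`), so the convergent upgrade
`LatticeUniversality.Birth.tendsto_integral_sub_of_tendstoLaw` (bounded-Lipschitz portmanteau) turns the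
Lipschitz merging into `C_b` merging; add the limit of the hexagonal side. [folklore] -/
theorem tendsto_integral_brickWall_of_lipMerging {B : ℂ ≃ₜ ℂ} {E : DobrushinDomain} {a b : ℝ → Site 2}
    {a' b' : ℝ → HexVertex} {Γ : (ℝ≥0 → ℝ) → CurveClass ℂ}
    (hprob : ∀ᶠ δ in nhdsWithin 0 (Set.Ioi 0),
      IsProbabilityMeasure (SAW.brickWallLaw E.carrier δ 0 (a δ) (b δ)))
    (hΓ : AEMeasurable Γ Literature.Probability.Process.preWienerMeasure)
    (hT : TendstoLaw (fun δ (γ : SAW.HexDomainSAW (E.map B.symm).carrier δ (a' δ) (b' δ)) => γ.curve)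
      (fun δ => SAW.hexSAWLaw (E.map B.symm).carrier δ (a' δ) (b' δ)) Γ
      Literature.Probability.Process.preWienerMeasure)
    (hEq : ∀ (δ : ℝ) (f : BoundedContinuousFunction (CurveClass ℂ) ℝ),
      (∫ γ, f γ.curve ∂(SAW.embLaw hexGraph (fun v : HexVertex => B (hexCenter v)) E.carrier δ
          SAW.hexCriticalFugacity (a' δ) (b' δ))) =
        ∫ γ, f (CurveClass.map (B : C(ℂ, ℂ)) γ.curve)
          ∂(SAW.hexSAWLaw (E.map B.symm).carrier δ (a' δ) (b' δ)))
    (hL : ∀ (g : BoundedContinuousFunction (CurveClass ℂ) ℝ) (L : NNReal), LipschitzWith L g →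
      Tendsto (fun δ => (∫ γ, g γ.curve ∂(SAW.brickWallLaw E.carrier δ 0 (a δ) (b δ))) -
        ∫ γ, g γ.curve ∂(SAW.embLaw hexGraph (fun v : HexVertex => B (hexCenter v)) E.carrier δ
          SAW.hexCriticalFugacity (a' δ) (b' δ)))
        (nhdsWithin 0 (Set.Ioi 0)) (nhds 0))
    (f : BoundedContinuousFunction (CurveClass ℂ) ℝ) :
    Tendsto (fun δ => ∫ γ, f γ.curve ∂(SAW.brickWallLaw E.carrier δ 0 (a δ) (b δ)))
      (nhdsWithin 0 (Set.Ioi 0))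
      (nhds (∫ ω, f (CurveClass.map (B : C(ℂ, ℂ)) (Γ ω)) ∂Literature.Probability.Process.preWienerMeasure)) := by
  haveI := Literature.Probability.RandomPlanarGeometry.isProbabilityMeasure_preWienerMeasure'
  -- the hexagonal curves pushed by `CurveClass.map B` converge in law to `CurveClass.map B ∘ Γ`
  have hY : TendstoLaw
      (fun δ (γ : SAW.HexDomainSAW (E.map B.symm).carrier δ (a' δ) (b' δ)) =>
        CurveClass.map (B : C(ℂ, ℂ)) γ.curve)
      (fun δ => SAW.hexSAWLaw (E.map B.symm).carrier δ (a' δ) (b' δ))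
      (fun ω => CurveClass.map (B : C(ℂ, ℂ)) (Γ ω)) Literature.Probability.Process.preWienerMeasure := by
    intro g
    have h := hT (g.compContinuous ⟨CurveClass.map (B : C(ℂ, ℂ)), CurveClass.continuous_map _⟩)
    simp only [BoundedContinuousFunction.compContinuous_apply, ContinuousMap.coe_mk] at h
    exact h
  -- Lipschitz merging of the straight law with the `B`-image of the hexagonal law (affine transport)
  have hLip1 : ∀ g : BoundedContinuousFunction (CurveClass ℂ) ℝ, LipschitzWith 1 g →
      Tendsto (fun δ : ℝ => (∫ γ, g γ.curve ∂(SAW.brickWallLaw E.carrier δ 0 (a δ) (b δ))) -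
        ∫ γ, g (CurveClass.map (B : C(ℂ, ℂ)) γ.curve)
          ∂(SAW.hexSAWLaw (E.map B.symm).carrier δ (a' δ) (b' δ)))
        (nhdsWithin 0 (Set.Ioi 0)) (nhds 0) := by
    intro g hg
    have h := hL g 1 hg
    simp only [hEq] at h
    exact h
  -- the convergent upgrade: merging on all bounded continuous functions
  have key :=
    Summit.CriticalPhenomena.SAWScalingLimit.Cruxes.LatticeUniversality.Birth.tendsto_integral_sub_of_tendstoLaw
      (X := fun δ (γ : SAW.DomainSAW E.carrier δ (a δ) (b δ)) => γ.curve)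
      (Y := fun δ (γ : SAW.HexDomainSAW (E.map B.symm).carrier δ (a' δ) (b' δ)) =>
        CurveClass.map (B : C(ℂ, ℂ)) γ.curve)
      (P := fun δ => SAW.brickWallLaw E.carrier δ 0 (a δ) (b δ))
      (Q := fun δ => SAW.hexSAWLaw (E.map B.symm).carrier δ (a' δ) (b' δ))
      (Z := fun ω => CurveClass.map (B : C(ℂ, ℂ)) (Γ ω))
      (P' := Literature.Probability.Process.preWienerMeasure)
      hprob (fun δ => SAW.DomainSAW.measurable_of_top _)
      ((CurveClass.measurable_map _).comp_aemeasurable hΓ) hY hLip1 f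
  have h := key.add (hY f)
  rw [zero_add] at h
  exact h.congr fun δ => sub_add_cancel _ _

/-- **STUB W1 — `stub_bwRobust_of_jitteredLipMerging`: (L) ⇒ (R).**  Bounded-Lipschitz merging of the straight
brick-wall law with the jittered law (L, literal `JitteredLipMerging`) upgrades, GIVEN `HexConjecture`, to
convergence in law of the straightened brick-wall curves `CurveClass.map B⁻¹ ∘ curve` to SLE₈⸝₃ in `B⁻¹E`: the
jittered curve integrals ARE hexagonal ones composed with `CurveClass.map B` and the transported endpoints form a
hexagonal endpoint approximation of `B⁻¹E` (`stub_affineTransport`, exact); `HexConjecture` there gives an SLE₈⸝₃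
random curve `Γ` of `B⁻¹E` with the hexagonal curves converging in law to `Γ`; by
`tendsto_integral_brickWall_of_lipMerging` the straight brick-wall curve laws converge, on every bounded
continuous test function, to the `CurveClass.map B`-image of the law of `Γ`; testing on `f ∘ CurveClass.map B⁻¹`
(`curveClass_map_symm_map`) gives `TendstoLaw` of the straightened curves to the SAME `Γ`, and measurability is
free on the finite discrete configuration space (`SAW.DomainSAW.measurable_of_top`). [folklore] -/
theorem stub_bwRobust_of_jitteredLipMerging :
    (∀ B : ℂ ≃ₜ ℂ, (∀ z : ℂ, B z = ((2 * z.re : ℝ) : ℂ) + ((2 / Real.sqrt 3 * z.im : ℝ) : ℂ) * Complex.I) → ∀ (E : DobrushinDomain) (a b : ℝ → Site 2), SAW.IsEndpointApprox E a b → (∀ᶠ δ in nhdsWithin 0 (Set.Ioi 0), IsProbabilityMeasure (SAW.brickWallLaw E.carrier δ 0 (a δ) (b δ))) → ∃ a' b' : ℝ → HexVertex, SAW.IsEmbEndpointApprox hexGraph (fun v : HexVertex => B (hexCenter v)) E a' b' ∧ ∀ (g : BoundedContinuousFunction (CurveClass ℂ) ℝ) (L : NNReal), LipschitzWith L g → Tendsto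 (fun δ => (∫ γ, g γ.curve ∂(SAW.brickWallLaw E.carrier δ 0 (a δ) (b δ))) - ∫ γ, g γ.curve ∂(SAW.embLaw hexGraph (fun v : HexVertex => B (hexCenter v)) E.carrier δ SAW.hexCriticalFugacity (a' δ) (b' δ))) (nhdsWithin 0 (Set.Ioi 0)) (nhds 0)) → Summit.CriticalPhenomena.SAWScalingLimit.Theses.SAWBrickWallHomotopy.HexConjecture → ∀ B : ℂ ≃ₜ ℂ, (∀ z : ℂ, B z = ((2 * z.re : ℝ) : ℂ) + ((2 / Real.sqrt 3 * z.im : ℝ) : ℂ) * Complex.I) → ∀ (E : DobrushinDomain) (a b : ℝ → Site 2), SAW.IsEndpointApprox E a b → (∀ᶠ δ in nhdsWithin 0 (Set.Ioi 0), IsProbabilityMeasure (SAW.brickWallLaw E.carrier δ 0 (a δ) (b δ))) → ConvergesInLawToSLE ((8 : NNReal) / 3) (E.map B.symm) (fun δ (γ : SAW.DomainSAW E.carrier δ (a δ) (b δ)) => CurveClass.map (B.symm : C(ℂ, ℂ)) γ.curve) (fun δ => SAW.brickWallLaw E.carrier δ 0 (a δ) (b δ)) := by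
  intro hL hHex B hB E a b hab hprob
  -- (L): a jittered endpoint approximation merging with the straight law on bounded Lipschitz functions
  obtain ⟨a', b', habj, hLip⟩ := hL B hB E a b hab hprob
  -- (T): exact affine transport to the hexagonal law of `B⁻¹E`
  obtain ⟨hab', hEq⟩ := stub_affineTransport B hB E a' b' habj
  -- (H): DCS Conjecture 1 in `B⁻¹E` at the transported endpoint approximation
  obtain ⟨Γ, hΓ, -, hT⟩ := hHex (E.map B.symm) a' b' hab'
  refine ⟨Γ, hΓ, Eventually.of_forall fun δ => (SAW.DomainSAW.measurable_of_top _).aemeasurable, ?_⟩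
  intro f
  have key := tendsto_integral_brickWall_of_lipMerging hprob hΓ.aemeasurable hT hEq hLip
    (f.compContinuous ⟨CurveClass.map (B.symm : C(ℂ, ℂ)), CurveClass.continuous_map _⟩)
  simp only [BoundedContinuousFunction.compContinuous_apply, ContinuousMap.coe_mk,
    curveClass_map_symm_map] at key
  exact key

end Summit.CriticalPhenomena.SAWScalingLimit.Cruxes.ModulusUniversality.Birth

end
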